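import Summits.ValiantsHypothesis.ValiantsHypothesis.Theses.ProjectionStability
import Summits.ValiantsHypothesis.ValiantsHypothesis.Theses.ProjectionRigidity
import Summits.ValiantsHypothesis.ValiantsHypothesis.Theorems.ProjectionStabilityOptStepStubGrenetProjection
import Summits.ValiantsHypothesis.ValiantsHypothesis.Theorems.ProjectionRigidityProjOptimalUniqueStubPdcPerThree
import Literature.Computability.AlgebraicComplexity.DeterminantalComplexityProofs
import Literature.Computability.AlgebraicComplexity.LandsbergRessayreNormalForm
import Literature.Computability.AlgebraicComplexity.LRPencilOfMatrix

/-!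
# Disproof of `UniqStep` (crux stmt-ValiantsHypothesis-17834, route `ProjectionStability`) — findings

Crux: `UniqStep = ∀ n ≥ 3, Opt n → Uniq n → Opt (n+1) → Uniq (n+1)` with
`Opt k := 2ᵏ − 1 ≤ pdc(per_k)` (`pdc = detProjectionComplexity`, Valiant's projection model: every cell
`X v` or `C c`) and `Uniq k :=` any two `pdc × pdc` honest projections of `per_k` are related by constant
gauge `GL × GL`, a substitution `γ ∈ permSymmetrySubst ℂ k`, possibly matrix transpose
(`uniqStep_iff`, `Iff.rfl`).  Cycle 1 of this seat (cdisprove, 2026-08-17); it EXTENDS the batch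
refuter's cycle (item note 2026-08-17T06:20Z: no second orbit at Hamming distance ≤ 2 of Grenet₃/Grenet₄,
landed `Theorems/UniqStep/Negative/UniqThreeFalseWithSignedEntries.lean` = the coefficient-ONE convention
is load-bearing) and the sibling `Cruxes/OptStep/Disproof.lean` (small models `pdc(per_1)=1`,
`pdc(per_2)=3`, copied below, not imported).

## Verdict: NO KILL (structurally impossible this cycle); ONE NEW SMALL-MODEL NEGATIVE: `¬ Uniq 2`.

(a) LOAD-BEARING ANALYSIS (all as theorems below).
* `¬ UniqStep ↔ ∃ n ≥ 3, Opt n ∧ Uniq n ∧ Opt (n+1) ∧ ¬ Uniq (n+1)` (`not_uniqStep_iff`).  Every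
  refutation must PROVE `Opt (n+1)` at some `n + 1 ≥ 4`, i.e. `pdc(per_4) ≥ 15` at the very least —
  open (HI16 p. 3: even `bdc(per_4)` is out of reach) — and the classification `Uniq n` (at `n = 3` this
  is the open finite base `UniqBase`, `uniqBase_iff_uniqAt : UniqBase ↔ UniqAt 3 7` by the in-tree
  `pdc(per_3) = 7`).  Dropping hypotheses (`UniqStepWithoutOpt`, `…WithoutUniq`, `…WithoutOptSucc`) only
  STRENGTHENS the crux; each mutation is open, none refutable, recorded as implications.
* **THE SIDE CONDITION `n ≥ 3` IS LOAD-BEARING** (new): the unguarded step is FALSE at `n = 1`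
  (`uniqStepBody_one_false`, `uniqStep_false_without_ge`): `Opt 1`, `Uniq 1`, `Opt 2` hold
  (`pdc(per_1) = 1`, `pdc(per_2) = 3 = 2² − 1`: GRENET IS OPTIMAL AT LEVEL 2) but **`Uniq 2` is FALSE**
  (`not_uniq_two`): the honest optimal projections
  `R = [[x₀₀, x₀₁, 0], [0, x₁₁, x₁₀], [1, 0, 1]]` (the optimal AFFINE representation
  `[[x₀₀, x₀₁], [−x₁₀, x₁₁]]`, `dc(per_2) = 2`, bordered to pay for its one sign) and Grenet₂
  `G = [[0, x₀₀, x₀₁], [x₁₁, −1, 0], [x₁₀, 0, −1]]` both have determinant `per_2`, and their constant parts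
  have rank `1` resp. `2` — an invariant of `B ↦ P·B(γx)·Q`, `B ↦ P·B(γx)ᵀ·Q` (`constPart_linSubstEntries`).
  Computation (folder `compute/per2_*.py`, exact arithmetic, exhaustive): the honest `3 × 3` projections of
  `per_2` over `ℂ` are exactly 1008 matrices (every pattern forces its constants) in EXACTLY TWO gauge orbits,
  864 in the orbit of `R`, 144 in the orbit of `G`; both orbits are `leftMonomialSubst`-EQUIVARIANT.
  Hence `UniqStep ↔ ∀ n ≠ 1, UniqStepBody n` (`uniqStep_iff_forall_ne_one`): levels 0 and 2 are true
  (vacuously at 2, BECAUSE `Uniq 2` fails).  CONSEQUENCE FOR PROVERS: no argument that is UNIFORM in `n`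
  (valid verbatim for every `n ≥ 1`) can prove the step; a proof must consume an ingredient that is false at
  `n + 1 = 2` and true from `n + 1 = 3` on — the natural one is the corank-one (ABP) normal form of EVERY
  affine representation of `per_{n+1}` (regularity, in tree as `isRegularDetRepr_perPoly` for `N ≥ 3`; FALSE at
  `N = 2`, as `R` shows: `codim Sing V(per_2) = 4`), which is exactly what separates the two level-2 orbits;
  the lead's S3 does route through regularity.
* MECHANISM of the level-2 failure, and why it is dead at levels 3, 4: the second orbit has CORANK-2
  constant part, i.e. it is an affine representation of smaller size in disguise (`dc < pdc`).  For `per_3`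
  and `per_4` every affine representation of ANY size `m` has `rank A(0) = m − 1` (batch refuter's note;
  von zur Gathen: `{corank ≥ 2}` has codimension ≤ 4 and lies in `Sing V(per_n)`, of dimension `4 < 5`
  (n = 3), `≤ 11 < 12` (n = 4); paper proof for (3,7) also in NOTES.md §rank).  So at the crux's levels a
  second orbit must be an honest CORANK-ONE (ABP-normal-form) matrix: a cancellative non-layered pattern or
  an unsigned matrix in the GL²-orbit of a signed Koszul twist — exactly the residual risk named by the
  planner.  Constant-free HOMOGENEOUS patterns are rigid: a variable-only layered ABP for `per_N` has
  ≥ `C(N,d)` nodes at depth `d` (each node covers ≤ `d!(N−d)!` permutation monomials), equality forces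
  full `(R,C)`-blocks partitioning `S_N` at every depth, the end layers are lines of one kind (rows, say
  `r₀` first and `r_last` last), and consecutive depths are linked by one-row Laplace expansions; EXHAUSTIVE
  enumeration (`compute/exact_cover_abp.py`): at `N = 4` the depth-2 exact covers number 2, at `N = 5` the
  depth-2 / depth-3 covers number 3 / 3, and the consistent chains number `(N−2)!` = 2 / 6 — exactly Grenet
  with the middle rows permuted.  So in the constant-free homogeneous sector `Uniq` HOLDS at levels 3, 4, 5;
  a second orbit needs constants or inhomogeneous (cancelling) paths.  (Overlaps idea card
  `torus-waist-exact-covers`.)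
(b) TIGHTNESS.  `Opt` is attained with equality at levels 1, 2 (and 3: `pdc(per_3) = 7`, in tree); the
  gauge of `Uniq` cannot be shrunk: without `γ` Grenet₃ and its variable-transpose differ (coefficient-rank
  profile), without signs see the landed signed-twist lemma; and at level 2 even the full gauge has 2 orbits.
(c) NATURAL STRENGTHENINGS refuted: "`UniqStep` from `n ≥ 1`" (`uniqStep_false_without_ge`); "uniqueness
  of optimal projections at every level where Grenet is optimal" (`not_forall_opt_uniq`: fails at 2).
(d) TARGETS.  payload.targets = [] (opening).  The lead's line `Lines/Sketch.lean` (equivariance split) was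
  read: S1 is in tree; S2 (scaling + full indecomposability) and S6 are TRUE on paper (NOTES.md §stubs);
  S7 (every honest optimal projection is `leftMonomialSubst`-equivariant up to variable-transpose) is, like
  the crux, refutable only modulo `UniqBase ∧ pdc(per_4) = 15`.  LEVEL-2 SANITY OF THE SPLIT: the analogue
  of S7 HOLDS at `N = 2` (both orbits are L-equivariant, checked by hand: row-swap lift of `R` is
  `(swap rows 0,1; swap columns 0,2)`), while the analogue of S3/S5 (equivariant + size `2^N − 1` ⇒ Grenet)
  FAILS at `N = 2` (`R`) — consistent with their hypothesis `N ≥ 3`, and showing that the rigidity half,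
  not the symmetry half, is where `N ≥ 3` (regularity / corank one) must enter.
(e) NEAR-MISSES: none sorried.  The decisive experiment remains a non-Grenet honest `15 × 15` projection of
  `per_4` (kill criterion as a theorem: `not_uniqStep_of_second_orbit_at_four`).

WHY IT RESISTS: an implication whose hypotheses contain an open exponential lower bound (`Opt (n+1)`,
`n + 1 ≥ 4`) and an open classification (`Uniq n`); its only level with a decidable first hypothesis
(`n = 3`) needs `pdc(per_4) ≥ 15` AND `UniqBase` before any witness pair can even be typed at size `pdc`.
-/

namespace Summit.ValiantsHypothesis.ValiantsHypothesis.Cruxes.UniqStep.Disproof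

set_option linter.dupNamespace false
set_option linter.unusedVariables false

open MvPolynomial Literature.Computability.AlgebraicComplexity
open scoped Matrix
open Summit.ValiantsHypothesis.ValiantsHypothesis.Theses.ProjectionStability (OptStep UniqBase UniqStep BootstrapAtThree)
open Summit.ValiantsHypothesis.ValiantsHypothesis.Theses.ProjectionRigidity (ProjOptimalUnique PdcPerFour GrenetProjection)

noncomputable section

/-! ## The crux unfolded -/

/-- `pdc(per_n)` over `ℂ`. -/
abbrev pdcPer (n : ℕ) : ℕ := detProjectionComplexity (perPoly (Fin n) ℂ)

/-- `Opt n`: Grenet is optimal among projections at level `n`. -/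
def Opt (n : ℕ) : Prop := 2 ^ n - 1 ≤ pdcPer n

/-- `UniqAt n m`: honest `m × m` projections of `per_n` are unique modulo constant gauge ×
`permSymmetrySubst` × transpose (the crux's uniqueness clause at an explicit size `m`). -/
def UniqAt (n m : ℕ) : Prop :=
  ∀ A B : Matrix (Fin m) (Fin m) (MvPolynomial (Fin n × Fin n) ℂ),
    (∀ i j, (∃ v, A i j = MvPolynomial.X v) ∨ ∃ c, A i j = MvPolynomial.C c) →
    (∀ i j, (∃ v, B i j = MvPolynomial.X v) ∨ ∃ c, B i j = MvPolynomial.C c) →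
    A.det = perPoly (Fin n) ℂ → B.det = perPoly (Fin n) ℂ →
    ∃ (P Q : GL (Fin m) ℂ) (γ : GL (Fin n × Fin n) ℂ), γ ∈ permSymmetrySubst ℂ n ∧
      (B = (P : Matrix _ _ ℂ).map MvPolynomial.C * Matrix.linSubstEntries γ A * (Q : Matrix _ _ ℂ).map MvPolynomial.C ∨
        B = (P : Matrix _ _ ℂ).map MvPolynomial.C * (Matrix.linSubstEntries γ A).transpose *
          (Q : Matrix _ _ ℂ).map MvPolynomial.C)

/-- `Uniq n`: uniqueness at the optimal size `pdc(per_n)` (verbatim the crux's clause). -/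
def Uniq (n : ℕ) : Prop := UniqAt n (pdcPer n)

/-- The body of the crux at level `n`. -/
def UniqStepBody (n : ℕ) : Prop := Opt n → Uniq n → Opt (n + 1) → Uniq (n + 1)

/-- The crux is literally `∀ n ≥ 3, UniqStepBody n`. -/
theorem uniqStep_iff : UniqStep ↔ ∀ n ≥ 3, UniqStepBody n := Iff.rfl

/-- The finite base of the route is literally `Uniq 3`. -/
theorem uniqBase_iff : UniqBase ↔ Uniq 3 := Iff.rfl

/-- Transport of the uniqueness clause along a computed value of `pdc`. -/
theorem uniq_iff_uniqAt {n m : ℕ} (h : pdcPer n = m) : Uniq n ↔ UniqAt n m := by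
  subst h; rfl

/-- `¬ UniqStep` unfolded: some level `n ≥ 3` has `Opt n ∧ Uniq n ∧ Opt (n+1)` and two inequivalent
optimal projections of `per_{n+1}`.  The conjunct `Opt (n+1)` (`n + 1 ≥ 4`) is an open lower bound. -/
theorem not_uniqStep_iff :
    ¬ UniqStep ↔ ∃ n ≥ 3, Opt n ∧ Uniq n ∧ Opt (n + 1) ∧ ¬ Uniq (n + 1) := by
  rw [uniqStep_iff]
  push Not
  simp only [UniqStepBody]
  refine exists_congr fun n => and_congr_right fun _ => ?_
  constructor
  · intro h
    push Not at h
    exact h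
  · rintro ⟨ho, hu, ho', hnu⟩ h
    exact hnu (h ho hu ho')

/-! ## (a) Small models: `pdc(per_n)` and `Uniq n` for `n ≤ 2`
(the `pdc` values and `uniq_one` are copied from the sibling workfile `Cruxes/OptStep/Disproof.lean`,
refuter-cdisprove-stmt-ValiantsHypothesis-17835; `not_uniq_two` is new) -/

/-- Substituting `a` into `DET_m` gives the determinant of the substituted matrix. [folklore] -/
theorem aeval_detPoly {σ : Type*} {m : ℕ} (a : Fin m × Fin m → MvPolynomial σ ℂ) :
    aeval a (detPoly (Fin m) ℂ) = (Matrix.of fun i j => a (i, j)).det := by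
  unfold detPoly
  rw [AlgHom.map_det]
  congr 1
  ext i j
  simp [Matrix.mvPolynomialX_apply]

/-- `per_2 = x₀₀ x₁₁ + x₀₁ x₁₀`. [folklore] -/
theorem perPoly_two_eq : perPoly (Fin 2) ℂ = X (0, 0) * X (1, 1) + X (0, 1) * X (1, 0) := by
  simp [perPoly, Matrix.permanent_fin_two_row]

/-- `per_2 (t, t, t, t) = 2t²`. [folklore] -/
theorem eval_const_perPoly_two (t : ℂ) : eval (fun _ => t) (perPoly (Fin 2) ℂ) = t * t + t * t := by
  rw [perPoly_two_eq]; simp only [map_add, map_mul, eval_X]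

/-- No projection of `DET_m`, `m ≤ 2`, equals `per_2` (second differences along `x = (t,t,t,t)`).
[folklore] -/
theorem not_isDetProjection_perPoly_two_of_le_two {m : ℕ} (hm : m ≤ 2) :
    ¬ IsDetProjection (perPoly (Fin 2) ℂ) m := by
  rintro ⟨a, ha, heq⟩
  rw [aeval_detPoly] at heq
  have E : ∀ t : ℂ, t * t + t * t = eval (fun _ => t) (Matrix.of fun i j => a (i, j)).det :=
    fun t => by rw [← eval_const_perPoly_two, heq]
  have h0 := E 0
  have h1 := E 1
  have h2 := E 2
  interval_cases m
  · simp only [Matrix.det_isEmpty, map_one] at h0 h1 h2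
    have hh : (4 : ℂ) = 0 := by linear_combination h2 - 2 * h1 + h0
    norm_num at hh
  · simp only [Matrix.det_fin_one, Matrix.of_apply] at h0 h1 h2
    rcases ha (0, 0) with ⟨v, e⟩ | ⟨c, e⟩ <;> simp only [e, eval_X, eval_C] at h0 h1 h2 <;>
    · have hh : (4 : ℂ) = 0 := by linear_combination h2 - 2 * h1 + h0
      norm_num at hh
  · simp only [Matrix.det_fin_two, Matrix.of_apply, map_sub, map_mul] at h0 h1 h2
    rcases ha (0, 0) with ⟨v₀, e₀⟩ | ⟨c₀, e₀⟩ <;> rcases ha (1, 1) with ⟨v₃, e₃⟩ | ⟨c₃, e₃⟩ <;>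
      rcases ha (0, 1) with ⟨v₁, e₁⟩ | ⟨c₁, e₁⟩ <;> rcases ha (1, 0) with ⟨v₂, e₂⟩ | ⟨c₂, e₂⟩ <;>
      simp only [e₀, e₁, e₂, e₃, eval_X, eval_C] at h0 h1 h2 <;>
      first
        | (have hh : (4 : ℂ) = 0 := by linear_combination h2 - 2 * h1 + h0); norm_num at hh
        | (have hh : (2 : ℂ) = 0 := by linear_combination h2 - 2 * h1 + h0); norm_num at hh
        | (have hh : (6 : ℂ) = 0 := by linear_combination h2 - 2 * h1 + h0); norm_num at hh

/-- Grenet's `3 × 3` projection: `per_2 = det [[0, x₀₀, x₀₁], [x₁₁, -1, 0], [x₁₀, 0, -1]]`. [folklore] -/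
theorem isDetProjection_perPoly_two_three : IsDetProjection (perPoly (Fin 2) ℂ) 3 := by
  let M : Matrix (Fin 3) (Fin 3) (MvPolynomial (Fin 2 × Fin 2) ℂ) :=
    !![C 0, X (0, 0), X (0, 1); X (1, 1), C (-1), C 0; X (1, 0), C 0, C (-1)]
  refine ⟨fun p => M p.1 p.2, fun p => ?_, ?_⟩
  · obtain ⟨i, j⟩ := p
    fin_cases i <;> fin_cases j
    · exact Or.inr ⟨0, rfl⟩
    · exact Or.inl ⟨(0, 0), rfl⟩
    · exact Or.inl ⟨(0, 1), rfl⟩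
    · exact Or.inl ⟨(1, 1), rfl⟩
    · exact Or.inr ⟨-1, rfl⟩
    · exact Or.inr ⟨0, rfl⟩
    · exact Or.inl ⟨(1, 0), rfl⟩
    · exact Or.inr ⟨0, rfl⟩
    · exact Or.inr ⟨-1, rfl⟩
  · rw [aeval_detPoly, perPoly_two_eq, Matrix.det_fin_three]
    simp [M]

/-- **`pdc(per_2) = 3 = 2² − 1`** — Grenet is optimal at level 2 (`Opt 2` with equality). [folklore] -/
theorem detProjectionComplexity_perPoly_two : pdcPer 2 = 3 := by
  have h3 := isDetProjection_perPoly_two_three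
  unfold pdcPer detProjectionComplexity
  apply le_antisymm (Nat.sInf_le h3)
  by_contra hlt
  push Not at hlt
  have hmem : sInf {m | IsDetProjection (perPoly (Fin 2) ℂ) m} ∈
      {m | IsDetProjection (perPoly (Fin 2) ℂ) m} := Nat.sInf_mem ⟨3, h3⟩
  exact not_isDetProjection_perPoly_two_of_le_two (by omega) hmem

/-- **`pdc(per_1) = 1 = 2¹ − 1`**. [folklore] -/
theorem detProjectionComplexity_perPoly_one : pdcPer 1 = 1 := by
  have hper1 : perPoly (Fin 1) ℂ = X (0, 0) := by
    simp [perPoly, Matrix.permanent_unique, Matrix.mvPolynomialX_apply]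
  have h1 : IsDetProjection (perPoly (Fin 1) ℂ) 1 := by
    refine ⟨fun _ => X (0, 0), fun _ => Or.inl ⟨(0, 0), rfl⟩, ?_⟩
    rw [aeval_detPoly, Matrix.det_fin_one, Matrix.of_apply, hper1]
  have h0 : ¬ IsDetProjection (perPoly (Fin 1) ℂ) 0 := by
    rintro ⟨a, -, heq⟩
    rw [aeval_detPoly, Matrix.det_isEmpty, hper1] at heq
    have := congr_arg (eval fun _ => (0 : ℂ)) heq
    simp at this
  unfold pdcPer detProjectionComplexity
  apply le_antisymm (Nat.sInf_le h1)
  by_contra hlt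
  push Not at hlt
  have hmem : sInf {m | IsDetProjection (perPoly (Fin 1) ℂ) m} ∈
      {m | IsDetProjection (perPoly (Fin 1) ℂ) m} := Nat.sInf_mem ⟨1, h1⟩
  have hz : sInf {m | IsDetProjection (perPoly (Fin 1) ℂ) m} = 0 := by omega
  rw [hz] at hmem
  exact h0 hmem

/-- `pdc(per_3) = 7` (in tree: Grenet + Alper–Bogart–Velasco). [cite: AlperBogartVelasco2017, Cor. 1.4] -/
theorem detProjectionComplexity_perPoly_three : pdcPer 3 = 7 :=
  Summit.ValiantsHypothesis.ValiantsHypothesis.Theorems.ProjectionRigidityProjOptimalUnique.stub_pdcPerThree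

/-- `Opt 1`, `Opt 2`, `Opt 3` hold (with equality). -/
theorem opt_one : Opt 1 := by unfold Opt; rw [detProjectionComplexity_perPoly_one]; norm_num
theorem opt_two : Opt 2 := by unfold Opt; rw [detProjectionComplexity_perPoly_two]; norm_num
theorem opt_three : Opt 3 := by unfold Opt; rw [detProjectionComplexity_perPoly_three]; norm_num

/-- `Uniq 1` holds: the only optimal projection of `per_1 = x₀₀` is the `1 × 1` matrix `(x₀₀)`. -/
theorem uniq_one : Uniq 1 := by
  intro A B hA hB hdA hdB
  have h1 := detProjectionComplexity_perPoly_one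
  haveI : Subsingleton (Fin (pdcPer 1)) := by rw [h1]; infer_instance
  obtain ⟨k⟩ : Nonempty (Fin (pdcPer 1)) := by rw [h1]; infer_instance
  rw [Matrix.det_eq_elem_of_subsingleton _ k] at hdA hdB
  have hAB : B = A := by
    ext i j
    rw [Subsingleton.elim i k, Subsingleton.elim j k, hdA, hdB]
  refine ⟨1, 1, 1, Subgroup.one_mem _, Or.inl ?_⟩
  simp [hAB, Matrix.map_one C C_0 C_1]

/-! ### NEW: `Uniq 2` is FALSE — two gauge orbits of optimal projections of `per_2` -/

/-- The constant part of a transpose. [folklore] -/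
theorem constPart_transpose {ι σ : Type*} (M : Matrix ι ι (MvPolynomial σ ℂ)) :
    constPart Mᵀ = (constPart M)ᵀ := Matrix.transpose_map

/-- **Two orbits at level 2, explicit size 3.**  `R = [[x₀₀, x₀₁, 0], [0, x₁₁, x₁₀], [1, 0, 1]]` (bordered
optimal AFFINE representation, constant part of rank 1) and Grenet₂
`G = [[0, x₀₀, x₀₁], [x₁₁, -1, 0], [x₁₀, 0, -1]]` (constant part of rank 2) are honest projections of
`DET_3` onto `per_2` which are NOT related by `(P, Q, γ)`, `γ ∈ permSymmetrySubst ℂ 2`, with or without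
transpose: constant parts transform by `Λ ↦ P Λ Q` / `P Λᵀ Q` (the substitution fixes constants), which
preserves "all `2 × 2` minors vanish". [folklore] -/
theorem not_uniqAt_two_three : ¬ UniqAt 2 3 := by
  intro h
  obtain ⟨R, hRdef⟩ : ∃ M : Matrix (Fin 3) (Fin 3) (MvPolynomial (Fin 2 × Fin 2) ℂ), M =
      !![X (0, 0), X (0, 1), C 0; C 0, X (1, 1), X (1, 0); C 1, C 0, C 1] := ⟨_, rfl⟩
  obtain ⟨G, hGdef⟩ : ∃ M : Matrix (Fin 3) (Fin 3) (MvPolynomial (Fin 2 × Fin 2) ℂ), M =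
      !![C 0, X (0, 0), X (0, 1); X (1, 1), C (-1), C 0; X (1, 0), C 0, C (-1)] := ⟨_, rfl⟩
  have hR : ∀ i j, (∃ v, R i j = X v) ∨ ∃ c, R i j = C c := by
    intro i j; subst hRdef
    fin_cases i <;> fin_cases j <;>
      first | exact Or.inl ⟨_, rfl⟩ | exact Or.inr ⟨_, rfl⟩
  have hG : ∀ i j, (∃ v, G i j = X v) ∨ ∃ c, G i j = C c := by
    intro i j; subst hGdef
    fin_cases i <;> fin_cases j <;>
      first | exact Or.inl ⟨_, rfl⟩ | exact Or.inr ⟨_, rfl⟩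
  have hdR : R.det = perPoly (Fin 2) ℂ := by
    subst hRdef; rw [perPoly_two_eq, Matrix.det_fin_three]; simp
  have hdG : G.det = perPoly (Fin 2) ℂ := by
    subst hGdef; rw [perPoly_two_eq, Matrix.det_fin_three]; simp
  have cR : constPart R = !![0, 0, 0; 0, 0, 0; 1, 0, 1] := by
    subst hRdef; ext i j; fin_cases i <;> fin_cases j <;> simp [constPart]
  have cG : constPart G = !![0, 0, 0; 0, -1, 0; 0, 0, -1] := by
    subst hGdef; ext i j; fin_cases i <;> fin_cases j <;> simp [constPart]
  obtain ⟨P, Q, γ, -, hPQ⟩ := h R G hR hG hdR hdG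
  rcases hPQ with e | e
  · have key := congrArg constPart e
    rw [constPart_mul, constPart_mul, constPart_map_C, constPart_map_C, constPart_linSubstEntries,
      cR, cG] at key
    have e11 := congrFun (congrFun key 1) 1
    have e12 := congrFun (congrFun key 1) 2
    have e21 := congrFun (congrFun key 2) 1
    have e22 := congrFun (congrFun key 2) 2
    simp [Matrix.mul_apply, Fin.sum_univ_three, -mul_eq_zero, -zero_eq_mul] at e11 e12 e21 e22
    have hh : (1 : ℂ) = 0 := by
      linear_combination ((P : Matrix (Fin 3) (Fin 3) ℂ) 2 2 * ((Q : Matrix (Fin 3) (Fin 3) ℂ) 0 2 +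
          (Q : Matrix (Fin 3) (Fin 3) ℂ) 2 2)) * e11 - e22 -
        ((P : Matrix (Fin 3) (Fin 3) ℂ) 2 2 * ((Q : Matrix (Fin 3) (Fin 3) ℂ) 0 1 +
          (Q : Matrix (Fin 3) (Fin 3) ℂ) 2 1)) * e12
    norm_num at hh
  · have key := congrArg constPart e
    rw [constPart_mul, constPart_mul, constPart_map_C, constPart_map_C, constPart_transpose,
      constPart_linSubstEntries, cR, cG] at key
    have e11 := congrFun (congrFun key 1) 1
    have e12 := congrFun (congrFun key 1) 2
    have e21 := congrFun (congrFun key 2) 1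
    have e22 := congrFun (congrFun key 2) 2
    simp [Matrix.mul_apply, Fin.sum_univ_three, -mul_eq_zero, -zero_eq_mul] at e11 e12 e21 e22
    have hh : (1 : ℂ) = 0 := by
      linear_combination (((P : Matrix (Fin 3) (Fin 3) ℂ) 2 0 + (P : Matrix (Fin 3) (Fin 3) ℂ) 2 2) *
          (Q : Matrix (Fin 3) (Fin 3) ℂ) 2 2) * e11 - e22 -
        (((P : Matrix (Fin 3) (Fin 3) ℂ) 2 0 + (P : Matrix (Fin 3) (Fin 3) ℂ) 2 2) *
          (Q : Matrix (Fin 3) (Fin 3) ℂ) 2 1) * e12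
    norm_num at hh

/-- **`Uniq 2` is false**: optimal (`3 × 3`, `pdc(per_2) = 3`) honest projections of `per_2` are NOT unique
modulo constant gauge × `permSymmetrySubst` × transpose. [folklore] -/
theorem not_uniq_two : ¬ Uniq 2 :=
  fun h => not_uniqAt_two_three ((uniq_iff_uniqAt detProjectionComplexity_perPoly_two).1 h)

/-! ### Consequences for the crux: the guard `n ≥ 3` is load-bearing, and nothing else below 3 is -/

/-- **The unguarded step FAILS at `n = 1`**: `Opt 1`, `Uniq 1`, `Opt 2` hold and `Uniq 2` fails. -/
theorem uniqStepBody_one_false : ¬ UniqStepBody 1 :=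
  fun h => not_uniq_two (h opt_one uniq_one opt_two)

/-- The crux WITHOUT its side condition `n ≥ 3`. -/
def UniqStepWithoutGe : Prop := ∀ n, UniqStepBody n

/-- **Load-bearing hypothesis**: any proof of `UniqStep` must use `n ≥ 3` (indeed `n ≥ 2`): the
`n`-unrestricted statement, and already its restriction to `n ≥ 1`, is false. -/
theorem uniqStep_false_without_ge : ¬ UniqStepWithoutGe := fun h => uniqStepBody_one_false (h 1)

theorem uniqStep_false_from_one : ¬ (∀ n ≥ 1, UniqStepBody n) :=
  fun h => uniqStepBody_one_false (h 1 le_rfl)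

/-- Level 0 of the body is TRUE (its conclusion `Uniq 1` holds). -/
theorem uniqStepBody_zero : UniqStepBody 0 := fun _ _ _ => uniq_one

/-- Level 2 of the body is TRUE — vacuously, because its hypothesis `Uniq 2` is false. -/
theorem uniqStepBody_two : UniqStepBody 2 := fun _ h2 => absurd h2 not_uniq_two

/-- Hence the crux is equivalent to its extension to every level except `n = 1`:
`UniqStep ↔ ∀ n ≠ 1, UniqStepBody n`; the guard `n ≥ 3` could be lowered to `n ≥ 2`, not further. -/
theorem uniqStep_iff_forall_ne_one : UniqStep ↔ ∀ n, n ≠ 1 → UniqStepBody n := by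
  rw [uniqStep_iff]
  refine ⟨fun h n hn => ?_, fun h n hn => h n (by omega)⟩
  match n, hn with
  | 0, _ => exact uniqStepBody_zero
  | 1, h1 => exact absurd rfl h1
  | 2, _ => exact uniqStepBody_two
  | (k + 3), _ => exact h (k + 3) (by omega)

/-- (c) The natural strengthening "optimal projections are unique at every level where Grenet is
optimal" is false (level 2). -/
theorem not_forall_opt_uniq : ¬ (∀ n, Opt n → Uniq n) := fun h => not_uniq_two (h 2 opt_two)

/-- … and so is the parent's global uniqueness extended down to level 2. -/
theorem not_forall_ge_two_uniq : ¬ (∀ n ≥ 2, Uniq n) := fun h => not_uniq_two (h 2 le_rfl)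

/-! ## (a') Dropping hypotheses only strengthens the crux: each mutation is OPEN, none refutable now -/

/-- without `Opt (n+1)`: uniqueness at level `n + 1` at whatever the optimal size is. OPEN (stronger). -/
def UniqStepWithoutOptSucc : Prop := ∀ n ≥ 3, Opt n → Uniq n → Uniq (n + 1)
/-- without `Uniq n`: OPEN (stronger; at `n = 3` it is `Opt 4 → Uniq 4` outright). -/
def UniqStepWithoutUniq : Prop := ∀ n ≥ 3, Opt n → Opt (n + 1) → Uniq (n + 1)
/-- without `Opt n`: OPEN (stronger). -/
def UniqStepWithoutOpt : Prop := ∀ n ≥ 3, Uniq n → Opt (n + 1) → Uniq (n + 1)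

theorem uniqStep_of_withoutOptSucc (h : UniqStepWithoutOptSucc) : UniqStep :=
  fun n hn ho hu _ => h n hn ho hu
theorem uniqStep_of_withoutUniq (h : UniqStepWithoutUniq) : UniqStep :=
  fun n hn ho _ ho' => h n hn ho ho'
theorem uniqStep_of_withoutOpt (h : UniqStepWithoutOpt) : UniqStep :=
  fun n hn _ hu ho' => h n hn hu ho'
/-- The parent's global crux implies this one. -/
theorem uniqStep_of_projOptimalUnique (h : ProjOptimalUnique) : UniqStep :=
  fun n hn _ _ _ => h (n + 1) (by omega)

/-! ## (d) The kill criterion and the position of level 3 -/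

/-- `pdc(per_4) ≤ 15` (Grenet₄ is a projection, in tree). [cite: Grenet2011, Thm. 1] -/
theorem pdcPer_four_le : pdcPer 4 ≤ 15 :=
  Nat.sInf_le (Summit.ValiantsHypothesis.ValiantsHypothesis.Theorems.ProjectionStabilityOptStep.GrenetProjection.stub_grenetProjection
    4 (by norm_num))

/-- `Opt 4 ↔ pdc(per_4) = 15` (the parent's certified-computation item `PdcPerFour`). -/
theorem opt_four_iff : Opt 4 ↔ PdcPerFour := by
  unfold Opt PdcPerFour
  change 2 ^ 4 - 1 ≤ pdcPer 4 ↔ pdcPer 4 = 15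
  have := pdcPer_four_le
  omega

/-- The base instance of the crux in explicit sizes: `UniqStepBody 3 ↔ (UniqAt 3 7 → pdc(per_4) = 15 →
UniqAt 4 15)`. -/
theorem uniqStepBody_three_iff :
    UniqStepBody 3 ↔ (UniqAt 3 7 → pdcPer 4 = 15 → UniqAt 4 15) := by
  unfold UniqStepBody
  rw [uniq_iff_uniqAt detProjectionComplexity_perPoly_three, opt_four_iff]
  unfold PdcPerFour
  change (Opt 3 → UniqAt 3 7 → pdcPer 4 = 15 → Uniq 4) ↔ (UniqAt 3 7 → pdcPer 4 = 15 → UniqAt 4 15)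
  constructor
  · intro h hu h4
    exact (uniq_iff_uniqAt h4).1 (h opt_three hu h4)
  · intro h _ hu h4
    exact (uniq_iff_uniqAt h4).2 (h hu h4)

/-- The finite base in explicit size: `UniqBase ↔ UniqAt 3 7`. -/
theorem uniqBase_iff_uniqAt : UniqBase ↔ UniqAt 3 7 :=
  uniq_iff_uniqAt detProjectionComplexity_perPoly_three

/-- **The planner's kill criterion is a theorem**: a second gauge orbit of honest `15 × 15` projections of
`per_4` refutes `UniqStep` — MODULO the two finite computations of the route, `UniqBase` (= `UniqAt 3 7`)
and `pdc(per_4) = 15`.  (No such pair is known; none exists at Hamming distance ≤ 2 from Grenet₄, batch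
refuter's job j023120.) -/
theorem not_uniqStep_of_second_orbit_at_four (hB : UniqBase) (h4 : pdcPer 4 = 15)
    (h2 : ¬ UniqAt 4 15) : ¬ UniqStep := fun hU =>
  h2 ((uniqStepBody_three_iff.1 (hU 3 le_rfl)) (uniqBase_iff_uniqAt.1 hB) h4)

/-- Conversely, modulo `PdcPerFour` the crux splits as the explicit level-3 instance and a tail every
instance of which carries the open target `Opt n`, `n ≥ 4`, as a hypothesis. -/
theorem uniqStep_iff_three_and_tail :
    UniqStep ↔ UniqStepBody 3 ∧ ∀ n ≥ 4, UniqStepBody n := by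
  rw [uniqStep_iff]
  refine ⟨fun h => ⟨h 3 le_rfl, fun n hn => h n (by omega)⟩, fun ⟨h3, h4⟩ n hn => ?_⟩
  rcases Nat.lt_or_ge n 4 with hlt | hge
  · obtain rfl : n = 3 := by omega
    exact h3
  · exact h4 n hge

/-- The route's bootstrap: the three cruxes give `Opt 4 ∧ Uniq 4` (so a refutation of `Uniq 4` at size
15 kills the CONJUNCTION `UniqBase ∧ OptStep ∧ UniqStep`, without pinning which conjunct dies). -/
theorem opt_four_and_uniq_four (hB : UniqBase) (hO : OptStep) (hU : UniqStep) : Opt 4 ∧ Uniq 4 :=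
  have ho : Opt 4 := hO 3 le_rfl opt_three hB
  ⟨ho, hU 3 le_rfl opt_three hB ho⟩

/-! ## (f) Toolkit for orbit tests at ANY level `(n, m)`: the coefficient-rank profile is a gauge invariant

A candidate second orbit `(A, B)` at `(4, 15)` (or anywhere) is certified inequivalent as soon as the
multisets of ranks of the coefficient matrices `coeffMat · v` differ (`exists_injective_rank_coeffMat_eq`;
this is the invariant used inline at `n = 3` by `Theorems/GrenetRigidityOptimalUniqueRefutation.lean` and
`Theorems/UniqStep/Negative/UniqThreeFalseWithSignedEntries.lean`, made reusable for every `n`), or the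
ranks of the constant parts differ (`rank_constPart_eq_of_gaugeRel`; useless at levels 3, 4 where the rank is
always `m − 1`, decisive at level 2). -/

section Toolkit

open Literature.Computability.AlgebraicComplexity.LRPencil
open scoped Kronecker

variable {n m : ℕ}

/-- The rank of the constant part is invariant under the crux's gauge relation. [folklore] -/
theorem rank_constPart_eq_of_gaugeRel {A B : Matrix (Fin m) (Fin m) (MvPolynomial (Fin n × Fin n) ℂ)}
    {P Q : GL (Fin m) ℂ} {γ : GL (Fin n × Fin n) ℂ}
    (h : B = (P : Matrix _ _ ℂ).map C * Matrix.linSubstEntries γ A * (Q : Matrix _ _ ℂ).map C ∨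
      B = (P : Matrix _ _ ℂ).map C * (Matrix.linSubstEntries γ A)ᵀ * (Q : Matrix _ _ ℂ).map C) :
    (constPart B).rank = (constPart A).rank := by
  have hP : IsUnit (P : Matrix (Fin m) (Fin m) ℂ).det :=
    (Matrix.isUnit_iff_isUnit_det _).1 (Units.isUnit P)
  have hQ : IsUnit (Q : Matrix (Fin m) (Fin m) ℂ).det :=
    (Matrix.isUnit_iff_isUnit_det _).1 (Units.isUnit Q)
  rcases h with e | e
  · have key := congrArg constPart e
    rw [constPart_mul, constPart_mul, constPart_map_C, constPart_map_C, constPart_linSubstEntries] at key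
    rw [key, Matrix.rank_mul_eq_left_of_isUnit_det _ _ hQ, Matrix.rank_mul_eq_right_of_isUnit_det _ _ hP]
  · have key := congrArg constPart e
    rw [constPart_mul, constPart_mul, constPart_map_C, constPart_map_C, constPart_transpose,
      constPart_linSubstEntries] at key
    rw [key, Matrix.rank_mul_eq_left_of_isUnit_det _ _ hQ, Matrix.rank_mul_eq_right_of_isUnit_det _ _ hP,
      Matrix.rank_transpose]

/-- **Every realised symmetry of `per_n` is a MONOMIAL substitution of the `n²` variables** (each row of
`γ ∈ permSymmetrySubst ℂ n` has at most one non-zero entry): the closure of Kronecker products of monomial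
matrices with `1` and of the transposition permutation.  (The `n = 3` instance is proved inline in
`Theorems/GrenetRigidityOptimalUniqueRefutation.lean`; same proof.) [cite: LandsbergRessayre2017, §2.1] -/
theorem permSymmetrySubst_row_monomial {γ : GL (Fin n × Fin n) ℂ} (hγ : γ ∈ permSymmetrySubst ℂ n) :
    ∀ i, ∃ (j : Fin n × Fin n) (c : ℂ), ∀ j',
      (γ : Matrix (Fin n × Fin n) (Fin n × Fin n) ℂ) i j' = if j' = j then c else 0 := by
  -- adapted from Summits/ValiantsHypothesis/ValiantsHypothesis/Theorems/GrenetRigidityOptimalUniqueRefutation.lean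
  have rm_mul : ∀ {ι : Type} [Fintype ι] [DecidableEq ι] {M N : Matrix ι ι ℂ},
      (∀ i, ∃ (j : ι) (c : ℂ), ∀ j', M i j' = if j' = j then c else 0) →
      (∀ i, ∃ (j : ι) (c : ℂ), ∀ j', N i j' = if j' = j then c else 0) →
      ∀ i, ∃ (j : ι) (c : ℂ), ∀ j', (M * N) i j' = if j' = j then c else 0 := by
    intro ι _ _ M N hM hN i
    obtain ⟨j, c, hj⟩ := hM i
    obtain ⟨l, d, hl⟩ := hN j
    refine ⟨l, c * d, fun j' => ?_⟩
    simp only [Matrix.mul_apply, hj, ite_mul, zero_mul, Finset.sum_ite_eq', Finset.mem_univ, if_true,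
      hl, mul_ite, mul_zero]
  have rm_diag : ∀ {ι : Type} [DecidableEq ι] (d : ι → ℂ),
      ∀ i, ∃ (j : ι) (c : ℂ), ∀ j', Matrix.diagonal d i j' = if j' = j then c else 0 := by
    intro ι _ d i
    refine ⟨i, d i, fun j' => ?_⟩
    by_cases h : j' = i
    · subst h; simp
    · simp [h, Matrix.diagonal_apply_ne _ (Ne.symm h)]
  have rm_perm : ∀ {ι : Type} [DecidableEq ι] (π : Equiv.Perm ι),
      ∀ i, ∃ (j : ι) (c : ℂ), ∀ j', π.permMatrix ℂ i j' = if j' = j then c else 0 := fun π i =>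
    ⟨π i, 1, fun j' => by simp [Equiv.Perm.permMatrix, PEquiv.toMatrix_apply, Equiv.toPEquiv_apply, eq_comm]⟩
  have inv_perm : ∀ {ι : Type} [Fintype ι] [DecidableEq ι] (π : Equiv.Perm ι),
      (π.permMatrix ℂ)⁻¹ = π⁻¹.permMatrix ℂ := by
    intro ι _ _ π
    apply Matrix.inv_eq_right_inv
    rw [← Matrix.permMatrix_mul, inv_mul_cancel, Matrix.permMatrix_one]
  have rm_kron : ∀ {ι κ : Type} [DecidableEq ι] [DecidableEq κ] {M : Matrix ι ι ℂ},
      (∀ i, ∃ (j : ι) (c : ℂ), ∀ j', M i j' = if j' = j then c else 0) →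
      (∀ i, ∃ (j : ι × κ) (c : ℂ), ∀ j', (M ⊗ₖ (1 : Matrix κ κ ℂ)) i j' = if j' = j then c else 0) ∧
      (∀ i, ∃ (j : κ × ι) (c : ℂ), ∀ j', ((1 : Matrix κ κ ℂ) ⊗ₖ M) i j' = if j' = j then c else 0) := by
    intro ι κ _ _ M hM
    constructor
    · rintro ⟨i, k⟩
      obtain ⟨j, c, hj⟩ := hM i
      refine ⟨(j, k), c, ?_⟩
      rintro ⟨j', k'⟩
      simp only [Matrix.kronecker_apply, hj, Matrix.one_apply, Prod.mk.injEq]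
      by_cases h1 : j' = j <;> by_cases h2 : k = k' <;> simp [h1, h2, eq_comm]
    · rintro ⟨k, i⟩
      obtain ⟨j, c, hj⟩ := hM i
      refine ⟨(k, j), c, ?_⟩
      rintro ⟨k', j'⟩
      simp only [Matrix.kronecker_apply, hj, Matrix.one_apply, Prod.mk.injEq]
      by_cases h1 : j' = j <;> by_cases h2 : k = k' <;> simp [h1, h2, eq_comm]
  have rm_mono : ∀ {m : ℕ} {g : GL (Fin m) ℂ}, g ∈ monomialSubgroup ℂ m →
      ∀ i, ∃ (j : Fin m) (c : ℂ), ∀ j', (g : Matrix (Fin m) (Fin m) ℂ) i j' = if j' = j then c else 0 := by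
    intro m g hg
    induction hg using Subgroup.closure_induction'' with
    | mem x hx =>
      rcases hx with ⟨π, hπ⟩ | ⟨d, hd⟩
      · rw [hπ]; exact rm_perm π
      · rw [hd]; exact rm_diag d
    | inv_mem x hx =>
      rcases hx with ⟨π, hπ⟩ | ⟨d, hd⟩
      · rw [Matrix.coe_units_inv, hπ, inv_perm]; exact rm_perm _
      · rw [Matrix.coe_units_inv, hd, Matrix.inv_diagonal]; exact rm_diag _
    | one => simpa using rm_diag (fun _ : Fin m => (1 : ℂ))
    | mul x y _ _ hx hy => rw [Units.val_mul]; exact rm_mul hx hy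
  have hleft : ∀ {γ : GL (Fin n × Fin n) ℂ}, γ ∈ leftMonomialSubst ℂ n →
      ∀ i, ∃ (j : Fin n × Fin n) (c : ℂ), ∀ j',
        (γ : Matrix (Fin n × Fin n) (Fin n × Fin n) ℂ) i j' = if j' = j then c else 0 := by
    intro γ hγ
    induction hγ using Subgroup.closure_induction'' with
    | mem x hx =>
      obtain ⟨g, hg, hx⟩ := hx
      rw [hx]; exact (rm_kron (rm_mono hg)).1
    | inv_mem x hx =>
      obtain ⟨g, hg, hx⟩ := hx
      rw [Matrix.coe_units_inv, hx, Matrix.inv_kronecker, inv_one, ← Matrix.coe_units_inv]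
      exact (rm_kron (rm_mono (Subgroup.inv_mem _ hg))).1
    | one => simpa using rm_diag (fun _ : Fin n × Fin n => (1 : ℂ))
    | mul x y _ _ hx hy => rw [Units.val_mul]; exact rm_mul hx hy
  have hright : ∀ {γ : GL (Fin n × Fin n) ℂ}, γ ∈ rightMonomialSubst ℂ n →
      ∀ i, ∃ (j : Fin n × Fin n) (c : ℂ), ∀ j',
        (γ : Matrix (Fin n × Fin n) (Fin n × Fin n) ℂ) i j' = if j' = j then c else 0 := by
    intro γ hγ
    induction hγ using Subgroup.closure_induction'' with
    | mem x hx =>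
      obtain ⟨g, hg, hx⟩ := hx
      rw [hx]; exact (rm_kron (rm_mono hg)).2
    | inv_mem x hx =>
      obtain ⟨g, hg, hx⟩ := hx
      rw [Matrix.coe_units_inv, hx, Matrix.inv_kronecker, inv_one, ← Matrix.coe_units_inv]
      exact (rm_kron (rm_mono (Subgroup.inv_mem _ hg))).2
    | one => simpa using rm_diag (fun _ : Fin n × Fin n => (1 : ℂ))
    | mul x y _ _ hx hy => rw [Units.val_mul]; exact rm_mul hx hy
  induction hγ using Subgroup.closure_induction'' with
  | mem x hx =>
    rcases hx with (hx | hx) | hx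
    · exact hleft hx
    · exact hright hx
    · have hx' : (x : Matrix (Fin n × Fin n) (Fin n × Fin n) ℂ) =
          Equiv.Perm.permMatrix ℂ (Equiv.prodComm (Fin n) (Fin n)) := hx
      rw [hx']; exact rm_perm _
  | inv_mem x hx =>
    rcases hx with (hx | hx) | hx
    · exact hleft (Subgroup.inv_mem _ hx)
    · exact hright (Subgroup.inv_mem _ hx)
    · have hx' : (x : Matrix (Fin n × Fin n) (Fin n × Fin n) ℂ) =
          Equiv.Perm.permMatrix ℂ (Equiv.prodComm (Fin n) (Fin n)) := hx
      rw [Matrix.coe_units_inv, hx', inv_perm]; exact rm_perm _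
  | one => simpa using rm_diag (fun _ : Fin n × Fin n => (1 : ℂ))
  | mul x y _ _ hx hy => rw [Units.val_mul]; exact rm_mul hx hy

/-- For an INVERTIBLE row-monomial matrix the row scalars are non-zero and the column choice is injective.
[folklore] -/
theorem row_monomial_unit {ι : Type*} [Fintype ι] [DecidableEq ι] (γ : GL ι ℂ) (w : ι → ι) (c : ι → ℂ)
    (h : ∀ i j', (γ : Matrix ι ι ℂ) i j' = if j' = w i then c i else 0) :
    (∀ i, c i ≠ 0) ∧ Function.Injective w := by
  have key : (γ : Matrix ι ι ℂ) * ((γ⁻¹ : GL ι ℂ) : Matrix ι ι ℂ) = 1 := by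
    rw [← Units.val_mul, mul_inv_cancel, Units.val_one]
  have entry : ∀ i i', c i * ((γ⁻¹ : GL ι ℂ) : Matrix ι ι ℂ) (w i) i' = if i = i' then 1 else 0 := by
    intro i i'
    have := congrFun (congrFun key i) i'
    rw [Matrix.mul_apply, Matrix.one_apply] at this
    simpa only [h, ite_mul, zero_mul, Finset.sum_ite_eq', Finset.mem_univ, if_true] using this
  have hc : ∀ i, c i ≠ 0 := by
    intro i hci
    have := entry i i
    rw [hci, zero_mul, if_pos rfl] at this
    exact zero_ne_one this
  refine ⟨hc, fun i i' hw => ?_⟩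
  by_contra hne
  have h1 := entry i i'
  have h2 := entry i' i'
  rw [if_neg hne, hw] at h1
  rw [if_pos rfl] at h2
  have hinv : ((γ⁻¹ : GL ι ℂ) : Matrix ι ι ℂ) (w i') i' ≠ 0 := by
    intro hz; rw [hz, mul_zero] at h2; exact zero_ne_one h2
  exact (mul_ne_zero (hc i) hinv) h1

/-- Honest matrices are affine. [folklore] -/
theorem totalDegree_le_one_of_honest {A : Matrix (Fin m) (Fin m) (MvPolynomial (Fin n × Fin n) ℂ)}
    (hA : ∀ i j, (∃ v, A i j = X v) ∨ ∃ c, A i j = C c) : ∀ i j, (A i j).totalDegree ≤ 1 := by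
  intro i j
  rcases hA i j with ⟨v, hv⟩ | ⟨c, hc⟩
  · rw [hv, totalDegree_X]
  · rw [hc, totalDegree_C]; exact Nat.zero_le _

/-- **The coefficient-rank profile is a gauge invariant.**  If `B = P·A(γx)·Q` or `B = P·A(γx)ᵀ·Q` with
`γ ∈ permSymmetrySubst ℂ n` and `A` honest, then there is an injective (hence bijective) relabelling
`w` of the variables with `rank (coeffMat B v) = rank (coeffMat A (w v))` for every `v`; in particular the
multisets of coefficient ranks of `A` and `B` coincide.  First test for any candidate second orbit.
[folklore] -/
theorem exists_injective_rank_coeffMat_eq {A B : Matrix (Fin m) (Fin m) (MvPolynomial (Fin n × Fin n) ℂ)}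
    {P Q : GL (Fin m) ℂ} {γ : GL (Fin n × Fin n) ℂ} (hγ : γ ∈ permSymmetrySubst ℂ n)
    (hA : ∀ i j, (∃ v, A i j = X v) ∨ ∃ c, A i j = C c)
    (h : B = (P : Matrix _ _ ℂ).map C * Matrix.linSubstEntries γ A * (Q : Matrix _ _ ℂ).map C ∨
      B = (P : Matrix _ _ ℂ).map C * (Matrix.linSubstEntries γ A)ᵀ * (Q : Matrix _ _ ℂ).map C) :
    ∃ w : Fin n × Fin n → Fin n × Fin n, Function.Injective w ∧
      ∀ v, (coeffMat B v).rank = (coeffMat A (w v)).rank := by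
  choose w c hwc using permSymmetrySubst_row_monomial hγ
  obtain ⟨hc, hinj⟩ := row_monomial_unit γ w c (fun i j' => hwc i j')
  have hP : IsUnit (P : Matrix (Fin m) (Fin m) ℂ).det :=
    (Matrix.isUnit_iff_isUnit_det _).1 (Units.isUnit P)
  have hQ : IsUnit (Q : Matrix (Fin m) (Fin m) ℂ).det :=
    (Matrix.isUnit_iff_isUnit_det _).1 (Units.isUnit Q)
  have hdeg := totalDegree_le_one_of_honest hA
  have hL : ∀ v, coeffMat (Matrix.linSubstEntries γ A) v = c v • coeffMat A (w v) := by
    intro v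
    rw [coeffMat_linSubstEntries γ A hdeg v]
    simp only [hwc v, ite_smul, zero_smul, Finset.sum_ite_eq', Finset.mem_univ, if_true]
  have hsmul : ∀ (v) (M : Matrix (Fin m) (Fin m) ℂ), (c v • M).rank = M.rank := by
    intro v M
    rw [Matrix.smul_eq_diagonal_mul]
    refine Matrix.rank_mul_eq_right_of_isUnit_det _ _ ?_
    rw [Matrix.det_diagonal, Finset.prod_const]
    exact (isUnit_iff_ne_zero.2 (hc v)).pow _
  refine ⟨w, hinj, fun v => ?_⟩
  rcases h with e | e
  · rw [e, coeffMat_C_mul_mul_C, Matrix.rank_mul_eq_left_of_isUnit_det _ _ hQ,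
      Matrix.rank_mul_eq_right_of_isUnit_det _ _ hP, hL, hsmul]
  · have ht : coeffMat (Matrix.linSubstEntries γ A)ᵀ v = (coeffMat (Matrix.linSubstEntries γ A) v)ᵀ :=
      Matrix.transpose_map
    rw [e, coeffMat_C_mul_mul_C, Matrix.rank_mul_eq_left_of_isUnit_det _ _ hQ,
      Matrix.rank_mul_eq_right_of_isUnit_det _ _ hP, ht, Matrix.rank_transpose, hL, hsmul]

/-- Packaged first tests: differing constant-part rank, or a coefficient-rank value attained a different
number of times, refutes `UniqAt n m` for a given honest pair. [folklore] -/
theorem not_uniqAt_of_rank_constPart_ne {A B : Matrix (Fin m) (Fin m) (MvPolynomial (Fin n × Fin n) ℂ)}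
    (hA : ∀ i j, (∃ v, A i j = X v) ∨ ∃ c, A i j = C c)
    (hB : ∀ i j, (∃ v, B i j = X v) ∨ ∃ c, B i j = C c)
    (hdA : A.det = perPoly (Fin n) ℂ) (hdB : B.det = perPoly (Fin n) ℂ)
    (hr : (constPart A).rank ≠ (constPart B).rank) : ¬ UniqAt n m := fun h => by
  obtain ⟨P, Q, γ, -, hPQ⟩ := h A B hA hB hdA hdB
  exact hr (rank_constPart_eq_of_gaugeRel hPQ).symm

theorem not_uniqAt_of_card_rank_ne {A B : Matrix (Fin m) (Fin m) (MvPolynomial (Fin n × Fin n) ℂ)}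
    (hA : ∀ i j, (∃ v, A i j = X v) ∨ ∃ c, A i j = C c)
    (hB : ∀ i j, (∃ v, B i j = X v) ∨ ∃ c, B i j = C c)
    (hdA : A.det = perPoly (Fin n) ℂ) (hdB : B.det = perPoly (Fin n) ℂ) (r : ℕ)
    (hr : (Finset.univ.filter fun v => (coeffMat A v).rank = r).card ≠
      (Finset.univ.filter fun v => (coeffMat B v).rank = r).card) : ¬ UniqAt n m := fun h => by
  obtain ⟨P, Q, γ, hγ, hPQ⟩ := h A B hA hB hdA hdB
  obtain ⟨w, hinj, hw⟩ := exists_injective_rank_coeffMat_eq hγ hA hPQ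
  have hbij : Function.Bijective w := (Finite.injective_iff_bijective).1 hinj
  apply hr
  symm
  refine Finset.card_bij (fun v _ => w v) (fun v hv => ?_) (fun v _ v' _ h => hinj h) (fun u hu => ?_)
  · simp only [Finset.mem_filter, Finset.mem_univ, true_and] at hv ⊢
    rw [← hw v]; exact hv
  · obtain ⟨v, rfl⟩ := hbij.2 u
    refine ⟨v, ?_, rfl⟩
    simp only [Finset.mem_filter, Finset.mem_univ, true_and] at hu ⊢
    rw [hw v]; exact hu

end Toolkit

end

end Summit.ValiantsHypothesis.ValiantsHypothesis.Cruxes.UniqStep.Disproof
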